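import Summits.Ventures.PercRepro.C026ThreeSem

/-!
# Bit-planes for the 6-vertex gadget, II: cell sums (p5, gen 13)

The per-state values of the bit-sliced adders, levels and comparator; the cells `expand`; the cell-sum
identity `valAt_levels`; the generic inequality `cell_le_of_ltP_eq_zero` from a vanishing check plane.
-/

namespace PercRepro

namespace Plane6
open PairModel

/-! ### II. Cell sums: per-state values of plane lists, adders, levels, the comparator -/

/-- Adding a carry plane adds the carry bit to the value. -/
theorem valAt_addC (b : List ℕ) (c s : ℕ) : valAt (addC b c) s = valAt b s + (c.testBit s).toNat := by
  induction b generalizing c with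
  | nil => simp [addC, valAt]
  | cons p ps ih =>
    simp only [addC, valAt, ih, Nat.testBit_xor, Nat.testBit_and]
    cases p.testBit s <;> cases c.testBit s <;> simp <;> omega

/-- The ripple-carry adder adds the values (and the carry bit). -/
theorem valAt_addP (a b : List ℕ) (c s : ℕ) :
    valAt (addP a b c) s = valAt a s + valAt b s + (c.testBit s).toNat := by
  induction a generalizing b c with
  | nil => simp [addP, valAt_addC, valAt]
  | cons p ps ih =>
    cases b with
    | nil =>
      simp only [addP, valAt, ih, Nat.testBit_xor, Nat.testBit_and]
      cases p.testBit s <;> cases c.testBit s <;> simp <;> omega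
    | cons q qs =>
      simp only [addP, valAt, ih, Nat.testBit_xor, Nat.testBit_and, Nat.testBit_or]
      cases p.testBit s <;> cases q.testBit s <;> cases c.testBit s <;> simp <;> omega

/-- The value of a masked shifted list: the value at the shifted position where the mask is set, else `0`. -/
theorem valAt_map_shift (x : List ℕ) (d m s : ℕ) :
    valAt (x.map fun p => (p >>> d) &&& m) s = if m.testBit s then valAt x (d + s) else 0 := by
  induction x with
  | nil => simp [valAt]
  | cons p ps ih =>
    simp only [List.map, valAt, ih, Nat.testBit_and, Nat.testBit_shiftRight]
    split_ifs with h <;> simp [h]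

/-- The value after a level: the value plus, at an open position of the class, the value at its closed position. -/
theorem valAt_level (i : ℕ) (x : List ℕ) (s : ℕ) :
    valAt (level i x) s = valAt x s + if (openMask i).testBit s then valAt x (off i + s) else 0 := by
  simp [level, valAt_addP, valAt_map_shift]

/-- Bit `s` of `anyP`: the accumulator, or some bit of the list at `s`. -/
theorem testBit_anyP (bs : List ℕ) (l s : ℕ) :
    (anyP bs l).testBit s = (decide (0 < valAt bs s) || l.testBit s) := by
  induction bs generalizing l with
  | nil => simp [anyP, valAt]
  | cons b bs ih =>
    simp only [anyP, ih, Nat.testBit_or, valAt]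
    rcases Bool.eq_false_or_eq_true (b.testBit s) with h | h <;> simp [h]

/-- One step of the bit-sliced comparison, on values. -/
theorem lt_step (A B : ℕ) (pb qb lb : Bool) :
    (decide (A < B) || (decide (A = B) && ((!pb && qb) || (!(pb ^^ qb) && lb)))) =
      (decide (pb.toNat + 2 * A < qb.toNat + 2 * B) ||
        (decide (pb.toNat + 2 * A = qb.toNat + 2 * B) && lb)) := by
  rcases Nat.lt_trichotomy A B with h | h | h
  · have hp : pb.toNat ≤ 1 := by cases pb <;> simp
    have hq : qb.toNat ≤ 1 := by cases qb <;> simp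
    have h1 : pb.toNat + 2 * A < qb.toNat + 2 * B := by omega
    have h2 : pb.toNat + 2 * A ≠ qb.toNat + 2 * B := by omega
    simp [h, h1, h2, Nat.ne_of_lt h]
  · subst h
    cases pb <;> cases qb <;> cases lb <;> simp
  · have hp : pb.toNat ≤ 1 := by cases pb <;> simp
    have hq : qb.toNat ≤ 1 := by cases qb <;> simp
    have h1 : ¬ (pb.toNat + 2 * A < qb.toNat + 2 * B) := by omega
    have h2 : pb.toNat + 2 * A ≠ qb.toNat + 2 * B := by omega
    simp [h1, h2, Nat.ne_of_gt h, not_lt_of_gt h]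

/-- Bit `s` of the bit-sliced comparison: `a < b` at `s`, or `a = b` at `s` and the accumulator. -/
theorem testBit_ltP {s : ℕ} (hs : s < NS) (a b : List ℕ) (l : ℕ) :
    (ltP a b l).testBit s =
      (decide (valAt a s < valAt b s) || (decide (valAt a s = valAt b s) && l.testBit s)) := by
  induction a generalizing b l with
  | nil =>
    simp only [ltP, testBit_anyP, valAt]
    rcases Bool.eq_false_or_eq_true (l.testBit s) with h | h
    · simp [h]; omega
    · simp [h]
  | cons p ps ih =>
    cases b with
    | nil =>
      simp only [ltP, ih, Nat.testBit_and, testBit_notP hs, valAt]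
      rcases Bool.eq_false_or_eq_true (p.testBit s) with h1 | h1 <;>
        rcases Bool.eq_false_or_eq_true (l.testBit s) with h2 | h2 <;> simp [h1, h2]
    | cons q qs =>
      simp only [ltP, ih, Nat.testBit_or, Nat.testBit_and, Nat.testBit_xor, testBit_notP hs, valAt]
      exact lt_step (valAt ps s) (valAt qs s) (p.testBit s) (q.testBit s) (l.testBit s)

/-- A bit of an `and`-fold: the initial bit and every folded bit. -/
theorem testBit_foldl_and (f : ℕ → ℕ) (l : List ℕ) (init s : ℕ) :
    ((l.foldl (fun acc i => acc &&& f i) init).testBit s) = (init.testBit s && l.all fun i => (f i).testBit s) := by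
  induction l generalizing init with
  | nil => simp
  | cons i l ih => simp [List.foldl, ih, Nat.testBit_and, Bool.and_assoc]

/-- Bit `s` of the validity plane: no class of `s` is in the garbage state `(0, 1)`. -/
theorem testBit_valid {s : ℕ} (hs : s < NS) :
    valid.testBit s = true ↔ ∀ i < 12, s.testBit i = true ∨ s.testBit (12 + i) = false := by
  rw [valid, testBit_foldl_and, testBit_ones hs, Bool.true_and, List.all_eq_true]
  simp only [List.mem_range, Nat.testBit_or, testBit_notP hs, testBit_I hs, Bool.or_eq_true,
    Bool.not_eq_true']

/-! ### III. Cells -/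

/-- Bit `s` of the open mask of class `i` is `isOpenCls i s`. -/
theorem testBit_openMask {s : ℕ} (hs : s < NS) (i : ℕ) : (openMask i).testBit s = isOpenCls i s := by
  simp [openMask, isOpenCls, Nat.testBit_and, testBit_notP hs, testBit_I hs]

/-- Adding `2^m` at a clear bit: every other bit is unchanged. -/
theorem testBit_two_pow_add_of_not {x m : ℕ} (hx : x.testBit m = false) (j : ℕ) :
    (2 ^ m + x).testBit j = (decide (j = m) || x.testBit j) := by
  obtain ⟨a, b, hb, rfl⟩ : ∃ a b, b < 2 ^ (m + 1) ∧ x = 2 ^ (m + 1) * a + b :=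
    ⟨x / 2 ^ (m + 1), x % 2 ^ (m + 1), Nat.mod_lt _ (by positivity), (Nat.div_add_mod _ _).symm⟩
  have hbm : b.testBit m = false := by
    have := Nat.testBit_two_pow_mul_add a hb m
    simp at this; rwa [this] at hx
  have hb' : b < 2 ^ m := by
    apply Nat.lt_pow_two_of_testBit
    intro i hi
    rcases Nat.eq_or_lt_of_le hi with rfl | hi'
    · exact hbm
    · exact Nat.testBit_lt_two_pow (lt_of_lt_of_le hb (Nat.pow_le_pow_right (by norm_num) hi'))
  have hsum : 2 ^ m + (2 ^ (m + 1) * a + b) = 2 ^ (m + 1) * a + (2 ^ m + b) := by ring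
  have hlt : 2 ^ m + b < 2 ^ (m + 1) := by rw [pow_succ]; omega
  rw [hsum, Nat.testBit_two_pow_mul_add a hlt, Nat.testBit_two_pow_mul_add a hb]
  by_cases hj : j < m + 1
  · simp only [hj, if_true]
    rcases Nat.lt_or_ge j m with h | h
    · rw [Nat.testBit_two_pow_add_gt h]; simp [Nat.ne_of_lt h]
    · have : j = m := by omega
      subst this
      rw [Nat.testBit_two_pow_add_eq, hbm]; simp
  · simp only [hj, if_false]
    have : j ≠ m := by omega
    simp [this]

/-- Subtracting `2^m` at a set bit: every other bit is unchanged. -/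
theorem testBit_sub_two_pow_of {x m : ℕ} (hx : x.testBit m = true) (j : ℕ) :
    (x - 2 ^ m).testBit j = (!decide (j = m) && x.testBit j) := by
  have hge : 2 ^ m ≤ x := by
    by_contra h
    rw [Nat.testBit_lt_two_pow (Nat.lt_of_not_le h)] at hx
    exact Bool.false_ne_true hx
  have hx' : (x - 2 ^ m).testBit m = false := by
    obtain ⟨a, b, hb, hxe⟩ : ∃ a b, b < 2 ^ (m + 1) ∧ x = 2 ^ (m + 1) * a + b :=
      ⟨x / 2 ^ (m + 1), x % 2 ^ (m + 1), Nat.mod_lt _ (by positivity), (Nat.div_add_mod _ _).symm⟩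
    have hbm : b.testBit m = true := by
      have := Nat.testBit_two_pow_mul_add a hb m
      simp at this; rw [hxe, this] at hx; exact hx
    have hbge : 2 ^ m ≤ b := by
      by_contra h
      rw [Nat.testBit_lt_two_pow (Nat.lt_of_not_le h)] at hbm
      exact Bool.false_ne_true hbm
    have hsub : x - 2 ^ m = 2 ^ (m + 1) * a + (b - 2 ^ m) := by omega
    have hlt : b - 2 ^ m < 2 ^ m := by rw [pow_succ] at hb; omega
    rw [hsub, Nat.testBit_two_pow_mul_add a (by rw [pow_succ]; omega)]
    simp [Nat.testBit_lt_two_pow hlt]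
  have key := testBit_two_pow_add_of_not hx' j
  rw [Nat.add_sub_cancel' hge] at key
  rw [key]
  by_cases hj : j = m
  · subst hj; simp [hx']
  · simp [hj]

/-- The bits of the flipped state: class `i` moves from `(1, 0)` to `(0, 1)`, nothing else changes. -/
theorem testBit_flip {i s : ℕ} (hi : i < 12) (h : isOpenCls i s = true) (j : ℕ) :
    (flip i s).testBit j =
      if j = i then false else if j = 12 + i then true else s.testBit j := by
  simp only [isOpenCls, Bool.and_eq_true, Bool.not_eq_true'] at h
  have h1 : 2 ^ i ≤ s := by
    by_contra hc
    rw [Nat.testBit_lt_two_pow (Nat.lt_of_not_le hc)] at h; exact Bool.false_ne_true h.1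
  have hflip : flip i s = 2 ^ (12 + i) + (s - 2 ^ i) := by
    unfold flip off
    have : 2 ^ i ≤ 2 ^ (12 + i) := Nat.pow_le_pow_right (by norm_num) (by omega)
    omega
  have hs' : (s - 2 ^ i).testBit (12 + i) = false := by
    rw [testBit_sub_two_pow_of h.1]; simp [h.2]
  rw [hflip, testBit_two_pow_add_of_not hs', testBit_sub_two_pow_of h.1]
  by_cases hj1 : j = i
  · subst hj1; simp
  · by_cases hj2 : j = 12 + i
    · subst hj2; simp
    · simp [hj1, hj2]

/-- `flip i` is injective. -/
theorem flip_injective (i : ℕ) : Function.Injective (flip i) := fun _ _ h => by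
  unfold flip at h; omega

/-- The cell of the state `s` over the classes `< k`: the states obtained by moving any subset of the
open classes `< k` of `s` to their closed positions. -/
def expand : ℕ → ℕ → Finset ℕ
  | 0, s => {s}
  | k + 1, s => if isOpenCls k s then expand k s ∪ (expand k s).image (flip k) else expand k s

/-- Members of the cell agree with `s` on the classes `≥ k`. -/
theorem agree_of_mem_expand {k : ℕ} (hk : k ≤ 12) {s t : ℕ} (ht : t ∈ expand k s) :
    ∀ j, (k ≤ j ∧ j < 12) ∨ (12 + k ≤ j) → t.testBit j = s.testBit j := by
  induction k generalizing t with
  | zero => simp [expand] at ht; subst ht; intros; rfl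
  | succ k ih =>
    intro j hj
    simp only [expand] at ht
    have hk' : k ≤ 12 := by omega
    split_ifs at ht with ho
    · rw [Finset.mem_union, Finset.mem_image] at ht
      rcases ht with ht | ⟨u, hu, rfl⟩
      · exact ih hk' ht j (by omega)
      · have hu' := ih hk' hu
        have huo : isOpenCls k u = true := by
          simp only [isOpenCls, Bool.and_eq_true, Bool.not_eq_true'] at ho ⊢
          rw [hu' k (by omega), hu' (12 + k) (by omega)]; exact ho
        rw [testBit_flip (by omega) huo]
        have hj1 : j ≠ k := by omega
        have hj2 : j ≠ 12 + k := by omega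
        simp only [hj1, hj2, if_false]
        exact hu' j (by omega)
    · exact ih hk' ht j (by omega)

/-- The cell sum: the value of `levels k x` at `s` is the sum of the values of `x` over the cell. -/
theorem valAt_levels {s : ℕ} (hs : s < NS) (x : List ℕ) :
    ∀ k, k ≤ 12 → valAt (levels k x) s = ∑ t ∈ expand k s, valAt x t := by
  intro k
  induction k generalizing x with
  | zero => intro _; simp [levels, expand]
  | succ k ih =>
    intro hk
    have hk' : k ≤ 12 := by omega
    simp only [levels, expand]
    rw [ih (level k x) hk']
    simp only [valAt_level]
    rw [Finset.sum_add_distrib]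
    have hagree : ∀ t ∈ expand k s, (openMask k).testBit t = isOpenCls k s := by
      intro t ht
      have htlt : t < NS := by
        -- every member of the cell is below `NS`: bits ≥ 24 agree with `s`
        apply Nat.lt_pow_two_of_testBit
        intro j hj
        rw [agree_of_mem_expand hk' ht j (by omega)]
        exact Nat.testBit_lt_two_pow (lt_of_lt_of_le hs (Nat.pow_le_pow_right (by norm_num) hj))
      rw [testBit_openMask htlt]
      simp only [isOpenCls]
      rw [agree_of_mem_expand hk' ht k (by omega), agree_of_mem_expand hk' ht (12 + k) (by omega)]
    split_ifs with ho
    · rw [Finset.sum_union, Finset.sum_image (fun _ _ _ _ h => flip_injective k h)]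
      · congr 1
        apply Finset.sum_congr rfl
        intro t ht
        rw [hagree t ht, ho]; rfl
      · rw [Finset.disjoint_left]
        intro t ht hti
        rw [Finset.mem_image] at hti
        obtain ⟨u, hu, rfl⟩ := hti
        have huo : isOpenCls k u = true := by
          have := hagree u hu; rw [ho] at this
          have hult : u < NS := by
            apply Nat.lt_pow_two_of_testBit
            intro j hj
            rw [agree_of_mem_expand hk' hu j (by omega)]
            exact Nat.testBit_lt_two_pow (lt_of_lt_of_le hs (Nat.pow_le_pow_right (by norm_num) hj))
          rwa [testBit_openMask hult] at this
        have h1 := agree_of_mem_expand hk' ht k (by omega)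
        rw [testBit_flip (by omega) huo k] at h1
        simp only [if_true] at h1
        simp only [isOpenCls, Bool.and_eq_true] at ho
        rw [ho.1] at h1
        exact Bool.false_ne_true h1
    · rw [show (∑ t ∈ expand k s, if (openMask k).testBit t = true then valAt x (off k + t) else 0) = 0 from ?_]
      · simp
      · apply Finset.sum_eq_zero
        intro t ht
        rw [hagree t ht]; simp [ho]

/-! ### IV. From the check plane to the cells (generic in the planes) -/

/-- **From the kernel check to the cells**: if `ltP P M 0 &&& V = 0`, every position `s` with
`V.testBit s` has `valAt M s ≤ valAt P s`. -/
theorem valAt_le_of_ltP_eq_zero {P M : List ℕ} {V : ℕ} (h : ltP P M 0 &&& V = 0) {s : ℕ} (hs : s < NS)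
    (hv : V.testBit s = true) : valAt M s ≤ valAt P s := by
  have hb : (ltP P M 0 &&& V).testBit s = false := by rw [h]; simp
  rw [Nat.testBit_and, testBit_ltP hs, hv, Nat.zero_testBit] at hb
  by_contra hc
  rw [not_le] at hc
  simp [hc] at hb

/-- The cell form: the level sums at a valid representative compare as the cell sums. -/
theorem cell_le_of_ltP_eq_zero {x y : List ℕ} {V : ℕ} (h : ltP (levels 12 x) (levels 12 y) 0 &&& V = 0)
    {s : ℕ} (hs : s < NS) (hv : V.testBit s = true) :
    ∑ t ∈ expand 12 s, valAt y t ≤ ∑ t ∈ expand 12 s, valAt x t := by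
  rw [← valAt_levels hs _ 12 le_rfl, ← valAt_levels hs _ 12 le_rfl]
  exact valAt_le_of_ltP_eq_zero h hs hv

/-- The value of the two `plus` planes `b ∧ (x ⊕ y)`, `b ∧ x ∧ y` at `t`: `x + y` on `b`. -/
theorem valAt_two (b x y t : ℕ) :
    valAt [b &&& (x ^^^ y), b &&& (x &&& y)] t =
      if b.testBit t then (x.testBit t).toNat + (y.testBit t).toNat else 0 := by
  simp only [valAt, Nat.testBit_and, Nat.testBit_xor]
  rcases Bool.eq_false_or_eq_true (b.testBit t) with h1 | h1 <;>
    rcases Bool.eq_false_or_eq_true (x.testBit t) with h2 | h2 <;>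
    rcases Bool.eq_false_or_eq_true (y.testBit t) with h3 | h3 <;> simp [h1, h2, h3]

/-- The value of the `minus` plane `b ∧ z` at `t`. -/
theorem valAt_one (b z t : ℕ) : valAt [b &&& z] t = if b.testBit t then (z.testBit t).toNat else 0 := by
  simp only [valAt, Nat.testBit_and]
  rcases Bool.eq_false_or_eq_true (b.testBit t) with h1 | h1 <;>
    rcases Bool.eq_false_or_eq_true (z.testBit t) with h2 | h2 <;> simp [h1, h2]


end Plane6

end PercRepro
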